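import Summits.ValiantsHypothesis.ValiantsHypothesis.Theses.LacunarySymmetroid
import Summits.ValiantsHypothesis.ValiantsHypothesis.Theorems.LacunarySymmetroidMatrixDescartesCensusFatSectors
import Summits.ValiantsHypothesis.ValiantsHypothesis.Theorems.LacunarySymmetroidMatrixDescartesCensusSupportNormalForm
import Summits.ValiantsHypothesis.ValiantsHypothesis.Theorems.LacunarySymmetroidMatrixDescartesStubBlockSector
import Summits.ValiantsHypothesis.ValiantsHypothesis.Theorems.LacunarySymmetroidMatrixDescartesFirstRung

/-!
# `MatrixDescartes` — format monotonicity of the census rows, and three normal forms of the crux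

HONEST FRAMING.  Object-search cell `pub-symmetroid`, crux `Theses.LacunarySymmetroid.MatrixDescartes`
(ledger item `stmt-ValiantsHypothesis-18050`, route `LacunarySymmetroid`; seat `val-sym-mdr-p1`).  The crux implies
`VP ≠ VNP` by the route's assembly and is at least summit-hard; NOTHING here is progress on it and nothing here is a
claim about `VP ≠ VNP`.  This file is elementary bookkeeping, companion to `…CensusFatSectors.lean`:

* §1 **Term monotonicity.**  A row at `K'` terms gives the row at every `K ≤ K'` (pad with zero coefficients):
  `posRootLawAt_of_le_terms`, `realRootLawAt_of_le_terms` — `ζ(m,K)` and `M(m,K)` are monotone in `K`.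
* §2 **Size monotonicity.**  A row at size `m'` gives the row at every `m ≤ m'` (`K ≥ 1`; pad every coefficient with an
  identity block: `det` acquires the factor `(∑ X^(d l))^n`, which only ADDS roots): `posRootLawAt_of_le_size`,
  `realRootLawAt_of_le_size` — `ζ(m,K)`, `M(m,K)` are monotone in `m` («term monotonicity» of `HOME/CONJECTURE.md`
  §2.1c at the format level, kernel form).
* §3 **The crux at the top size only.**  Hence `MatrixDescartes` is EQUIVALENT to the same sentence with the size
  FIXED at the top of the regime, `m = 2^((⌊log₂K⌋+c)^c)` (`matrixDescartes_iff_topSize`): one format per `(K, c)`.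
* §4 **The crux on strictly increasing supports.**  `MatrixDescartes` is equivalent to its restriction to exponent
  vectors `0 = d₀ < d₁ < ⋯` in `ζ`-currency (`matrixDescartes_iff_strictMonoSupport`; from the tree's
  `Census.matrixDescartes_iff_posRootLaw` and `Census.posRootLawAt_iff_strictMono`).
* §5 **The Loewner (one-sided) sector at all fat formats, `ζ`-currency.**  The tree's K-free rung
  `firstRung_oneSided` (`Z₊ ≤ m` when all terms but one are positive semidefinite and the exceptional exponent is
  extremal) is an instance of the crux's `ζ`-currency inequality `(2ζ+1)^q ≤ 2^(K⌊log₂K⌋)` at ALL fat formats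
  (`matrixDescartes_loewnerSector_pos`, via `Census.fatFormat_absorb`).  Sector theorem only; the reflected pencil of a
  Loewner pencil is not Loewner (odd exponent gaps flip signs), so no all-real-zeros version is claimed.

[folklore] Elementary; inputs `StubBlockSector.sum_smul_fromBlocks_map`, `Census.posRootLawAt_iff_strictMono`,
`Census.matrixDescartes_iff_posRootLaw`, `firstRung_oneSided`, `Census.fatFormat_absorb`.
-/

-- `Summit.ValiantsHypothesis.ValiantsHypothesis.…` repeats a component by the D-0017 layout
-- (single-conjunct summit), which the `dupNamespace` linter flags; the name is mandated.
set_option linter.dupNamespace false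

namespace Summit.ValiantsHypothesis.ValiantsHypothesis.Theorems.LacunarySymmetroidMatrixDescartes.Census

open Summit.ValiantsHypothesis.ValiantsHypothesis.Theses.LacunarySymmetroid (MatrixDescartes)
open Summit.ValiantsHypothesis.ValiantsHypothesis.Theorems.MatrixDescartes.Negative (PosRootLawAt)
open scoped BigOperators Matrix
open Polynomial

/-! ## §1 Term monotonicity: pad with zero coefficients -/

/-- Appending terms with zero coefficient matrices (on arbitrary exponents) does not change the pencil. [folklore] -/
theorem pencil_append_zero {m K j : ℕ} (d : Fin K → ℕ) (S : Fin K → Matrix (Fin m) (Fin m) ℝ)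
    (d₂ : Fin j → ℕ) :
    (∑ l, ((Polynomial.X : Polynomial ℝ) ^ Fin.append d d₂ l) •
        (Fin.append S (fun _ : Fin j => (0 : Matrix (Fin m) (Fin m) ℝ)) l).map Polynomial.C)
      = ∑ l, ((Polynomial.X : Polynomial ℝ) ^ d l) • (S l).map Polynomial.C := by
  rw [Fin.sum_univ_add]
  simp only [Fin.append_left, Fin.append_right, Matrix.map_zero _ Polynomial.C_0, smul_zero,
    Finset.sum_const_zero, add_zero]

/-- Appended zero coefficients are symmetric. [folklore] -/
theorem isSymm_append_zero {m K j : ℕ} (S : Fin K → Matrix (Fin m) (Fin m) ℝ) (hS : ∀ l, (S l).IsSymm)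
    (l : Fin (K + j)) : (Fin.append S (fun _ : Fin j => (0 : Matrix (Fin m) (Fin m) ℝ)) l).IsSymm := by
  induction l using Fin.addCases with
  | left i => rw [Fin.append_left]; exact hS i
  | right i => rw [Fin.append_right]; exact Matrix.isSymm_zero

/-- **Term monotonicity, positive zeros**: `PosRootLawAt m K' B → PosRootLawAt m K B` for `K ≤ K'` — a `K`-term pencil is
a `K'`-term pencil with `K' − K` zero coefficients; so `ζ(m,K)` is monotone in `K`. [folklore] -/
theorem posRootLawAt_of_le_terms {m K K' B : ℕ} (hK : K ≤ K') (h : PosRootLawAt m K' B) : PosRootLawAt m K B := by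
  obtain ⟨j, rfl⟩ := Nat.exists_eq_add_of_le hK
  intro d S hS
  have h1 := h (Fin.append d (fun _ : Fin j => 0)) (Fin.append S (fun _ : Fin j => 0)) (isSymm_append_zero S hS)
  rwa [pencil_append_zero] at h1

/-- **Term monotonicity, all real zeros**: `RealRootLawAt m K' B → RealRootLawAt m K B` for `K ≤ K'`; so `M(m,K)` is
monotone in `K`. [folklore] -/
theorem realRootLawAt_of_le_terms {m K K' B : ℕ} (hK : K ≤ K') (h : RealRootLawAt m K' B) :
    RealRootLawAt m K B := by
  obtain ⟨j, rfl⟩ := Nat.exists_eq_add_of_le hK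
  intro d S hS
  have h1 := h (Fin.append d (fun _ : Fin j => 0)) (Fin.append S (fun _ : Fin j => 0)) (isSymm_append_zero S hS)
  rwa [pencil_append_zero] at h1

/-! ## §2 Size monotonicity: pad with an identity block -/

/-- **Identity padding.**  Padding every coefficient `S l` with an `n × n` identity block (and re-indexing
`Fin m ⊕ Fin n ≃ Fin (m+n)`) multiplies the determinant of the pencil by `(∑ l, X^(d l))^n`. [folklore] -/
theorem det_pencil_padOne {m n K : ℕ} (d : Fin K → ℕ) (S : Fin K → Matrix (Fin m) (Fin m) ℝ) :
    Matrix.det (∑ l, ((Polynomial.X : Polynomial ℝ) ^ d l) •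
        (Matrix.reindex finSumFinEquiv finSumFinEquiv
          (Matrix.fromBlocks (S l) 0 0 (1 : Matrix (Fin n) (Fin n) ℝ))).map Polynomial.C)
      = Matrix.det (∑ l, ((Polynomial.X : Polynomial ℝ) ^ d l) • (S l).map Polynomial.C) *
          (∑ l, (Polynomial.X : Polynomial ℝ) ^ d l) ^ n := by
  have h1 : (∑ l, ((Polynomial.X : Polynomial ℝ) ^ d l) •
        (Matrix.reindex finSumFinEquiv finSumFinEquiv
          (Matrix.fromBlocks (S l) 0 0 (1 : Matrix (Fin n) (Fin n) ℝ))).map Polynomial.C)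
      = Matrix.reindex finSumFinEquiv finSumFinEquiv
          (∑ l, ((Polynomial.X : Polynomial ℝ) ^ d l) •
            (Matrix.fromBlocks (S l) 0 0 (1 : Matrix (Fin n) (Fin n) ℝ)).map Polynomial.C) := by
    ext i j
    simp only [Matrix.reindex_apply, Matrix.submatrix_apply, Matrix.sum_apply, Matrix.smul_apply,
      Matrix.map_apply]
  have h2 : (∑ l, ((Polynomial.X : Polynomial ℝ) ^ d l) • ((1 : Matrix (Fin n) (Fin n) ℝ).map Polynomial.C))
      = (∑ l, (Polynomial.X : Polynomial ℝ) ^ d l) • (1 : Matrix (Fin n) (Fin n) (Polynomial ℝ)) := by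
    rw [Matrix.map_one Polynomial.C (map_zero _) (map_one _), Finset.sum_smul]
  rw [h1, Matrix.det_reindex_self, StubBlockSector.sum_smul_fromBlocks_map, Matrix.det_fromBlocks_zero₂₁, h2,
    Matrix.det_smul, Matrix.det_one, mul_one, Fintype.card_fin]

/-- The padded coefficients are symmetric. [folklore] -/
theorem isSymm_padOne {m n : ℕ} {A : Matrix (Fin m) (Fin m) ℝ} (hA : A.IsSymm) :
    (Matrix.reindex finSumFinEquiv finSumFinEquiv
      (Matrix.fromBlocks A 0 0 (1 : Matrix (Fin n) (Fin n) ℝ))).IsSymm :=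
  (Matrix.IsSymm.fromBlocks hA (by simp) Matrix.isSymm_one).submatrix _

/-- For `K ≥ 1` the padding factor `∑ l, X^(d l)` is a nonzero polynomial (it evaluates to `K` at `1`). [folklore] -/
theorem sum_X_pow_ne_zero {K : ℕ} (hK : 0 < K) (d : Fin K → ℕ) :
    (∑ l, (Polynomial.X : Polynomial ℝ) ^ d l) ≠ 0 := by
  intro h
  have h1 : Polynomial.eval (1 : ℝ) (∑ l, (Polynomial.X : Polynomial ℝ) ^ d l) = K := by
    rw [Polynomial.eval_finsetSum]
    simp
  rw [h, Polynomial.eval_zero] at h1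
  have h2 : (K : ℝ) ≠ 0 := by exact_mod_cast hK.ne'
  exact h2 h1.symm

/-- Multiplying by a nonzero polynomial can only add roots: the distinct (resp. distinct positive) roots of `p` are
among those of `p * q`. [folklore] -/
theorem card_roots_le_of_mul (p q : Polynomial ℝ) (hq : q ≠ 0) :
    p.roots.toFinset.card ≤ (p * q).roots.toFinset.card ∧
      (p.roots.toFinset.filter (fun t => 0 < t)).card ≤
        ((p * q).roots.toFinset.filter (fun t => 0 < t)).card := by
  by_cases hp : p = 0
  · simp [hp]
  have hsub : p.roots.toFinset ⊆ (p * q).roots.toFinset := by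
    intro t ht
    rw [Multiset.mem_toFinset] at ht ⊢
    rw [Polynomial.roots_mul (mul_ne_zero hp hq)]
    exact Multiset.mem_add.2 (Or.inl ht)
  exact ⟨Finset.card_le_card hsub, Finset.card_le_card (Finset.filter_subset_filter _ hsub)⟩

/-- **Pencil-level padding.**  For `K ≥ 1`, every symmetric `K`-term pencil of size `m` embeds into one of size `m + n`
(identity padding) with at least as many distinct real zeros and at least as many distinct positive zeros. [folklore] -/
theorem exists_pad {m n K : ℕ} (hK : 0 < K) (d : Fin K → ℕ) (S : Fin K → Matrix (Fin m) (Fin m) ℝ)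
    (hS : ∀ l, (S l).IsSymm) :
    ∃ S' : Fin K → Matrix (Fin (m + n)) (Fin (m + n)) ℝ, (∀ l, (S' l).IsSymm) ∧
      (Matrix.det (∑ l, ((Polynomial.X : Polynomial ℝ) ^ d l) • (S l).map Polynomial.C)).roots.toFinset.card ≤
        (Matrix.det (∑ l, ((Polynomial.X : Polynomial ℝ) ^ d l) • (S' l).map Polynomial.C)).roots.toFinset.card ∧
      ((Matrix.det (∑ l, ((Polynomial.X : Polynomial ℝ) ^ d l) • (S l).map Polynomial.C)).roots.toFinset.filter
          (fun t => 0 < t)).card ≤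
        ((Matrix.det (∑ l, ((Polynomial.X : Polynomial ℝ) ^ d l) • (S' l).map Polynomial.C)).roots.toFinset.filter
          (fun t => 0 < t)).card := by
  refine ⟨fun l => Matrix.reindex finSumFinEquiv finSumFinEquiv
      (Matrix.fromBlocks (S l) 0 0 (1 : Matrix (Fin n) (Fin n) ℝ)), fun l => isSymm_padOne (hS l), ?_⟩
  rw [det_pencil_padOne]
  exact card_roots_le_of_mul _ _ (pow_ne_zero _ (sum_X_pow_ne_zero hK d))

/-- **Size monotonicity, positive zeros**: `PosRootLawAt m' K B → PosRootLawAt m K B` for `m ≤ m'` and `K ≥ 1`; so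
`ζ(m,K)` is monotone in `m`. [folklore] -/
theorem posRootLawAt_of_le_size {m m' K B : ℕ} (hK : 0 < K) (hm : m ≤ m') (h : PosRootLawAt m' K B) :
    PosRootLawAt m K B := by
  obtain ⟨n, rfl⟩ := Nat.exists_eq_add_of_le hm
  intro d S hS
  obtain ⟨S', hS', -, hle⟩ := exists_pad (n := n) hK d S hS
  exact hle.trans (h d S' hS')

/-- **Size monotonicity, all real zeros**: `RealRootLawAt m' K B → RealRootLawAt m K B` for `m ≤ m'` and `K ≥ 1`; so
`M(m,K)` is monotone in `m`. [folklore] -/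
theorem realRootLawAt_of_le_size {m m' K B : ℕ} (hK : 0 < K) (hm : m ≤ m') (h : RealRootLawAt m' K B) :
    RealRootLawAt m K B := by
  obtain ⟨n, rfl⟩ := Nat.exists_eq_add_of_le hm
  intro d S hS
  obtain ⟨S', hS', hle, -⟩ := exists_pad (n := n) hK d S hS
  exact hle.trans (h d S' hS')

/-! ## §3 The crux at the top size only -/

/-- **The crux at the top size of its regime.**  `MatrixDescartes` is EQUIVALENT to the same sentence with the size
fixed at `m = 2^((⌊log₂K⌋+c)^c)`: by size monotonicity every smaller size follows.  So the item is one row per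
`(K, c, q)`: `M(2^((⌊log₂K⌋+c)^c), K)^q ≤ 2^(K⌊log₂K⌋)` eventually in `K`.  (Bookkeeping; both sides are the open
crux.) [folklore] -/
theorem matrixDescartes_iff_topSize : MatrixDescartes ↔
    ∀ c q : ℕ, 0 < q → ∃ K₀ : ℕ, ∀ K : ℕ, K₀ ≤ K →
      ∀ (d : Fin K → ℕ)
        (S : Fin K → Matrix (Fin (2 ^ ((Nat.log 2 K + c) ^ c))) (Fin (2 ^ ((Nat.log 2 K + c) ^ c))) ℝ),
        (∀ l, (S l).IsSymm) →
          (Matrix.det (∑ l, ((Polynomial.X : Polynomial ℝ) ^ d l) • (S l).map Polynomial.C)).roots.toFinset.card ^ q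
            ≤ 2 ^ (K * Nat.log 2 K) := by
  constructor
  · intro h c q hq
    obtain ⟨K₀, hK₀⟩ := h c q hq
    exact ⟨K₀, fun K hK d S hS => hK₀ K _ hK le_rfl d S hS⟩
  · intro h c q hq
    obtain ⟨K₀, hK₀⟩ := h c q hq
    refine ⟨max 1 K₀, fun K m hK hm d S hS => ?_⟩
    have hK1 : 0 < K := lt_of_lt_of_le one_pos (le_of_max_le_left hK)
    obtain ⟨n, hn⟩ := Nat.exists_eq_add_of_le hm
    obtain ⟨S', hS', hle, -⟩ := exists_pad (n := n) hK1 d S hS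
    have h1 := hK₀ K (le_of_max_le_right hK) d
    rw [hn] at h1
    exact (Nat.pow_le_pow_left hle q).trans (h1 S' hS')

/-! ## §4 The crux on strictly increasing supports -/

/-- **The crux on normal-form supports, `ζ`-currency.**  `MatrixDescartes` is equivalent to: for all `c` and `q > 0`,
eventually in `K`, uniformly for `m ≤ 2^((⌊log₂(K+1)⌋+c)^c)`, some `B` with `(2B+1)^q ≤ 2^((K+1)⌊log₂(K+1)⌋)` bounds
the positive zeros of every `(K+1)`-term symmetric pencil whose exponents are STRICTLY INCREASING with `d 0 = 0`.
(The tree's `Census.matrixDescartes_iff_posRootLaw` and `Census.posRootLawAt_iff_strictMono`; the shift `K ↦ K+1`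
only avoids the empty format.) [folklore] -/
theorem matrixDescartes_iff_strictMonoSupport : MatrixDescartes ↔
    ∀ c q : ℕ, 0 < q → ∃ K₀ : ℕ, ∀ K m : ℕ, K₀ ≤ K → m ≤ 2 ^ ((Nat.log 2 (K + 1) + c) ^ c) →
      ∃ B : ℕ, (∀ d : Fin (K + 1) → ℕ, StrictMono d → d 0 = 0 →
          ∀ S : Fin (K + 1) → Matrix (Fin m) (Fin m) ℝ, (∀ l, (S l).IsSymm) →
            ((∑ l, (X : ℝ[X]) ^ d l • (S l).map C).det.roots.toFinset.filter (fun t => 0 < t)).card ≤ B) ∧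
        (2 * B + 1) ^ q ≤ 2 ^ ((K + 1) * Nat.log 2 (K + 1)) := by
  rw [matrixDescartes_iff_posRootLaw]
  constructor
  · intro h c q hq
    obtain ⟨K₀, hK₀⟩ := h c q hq
    refine ⟨K₀, fun K m hK hm => ?_⟩
    obtain ⟨B, hB, hBq⟩ := hK₀ (K + 1) m (by omega) hm
    exact ⟨B, (posRootLawAt_iff_strictMono m K B).1 hB, hBq⟩
  · intro h c q hq
    obtain ⟨K₀, hK₀⟩ := h c q hq
    refine ⟨K₀ + 1, fun K m hK hm => ?_⟩
    obtain ⟨k, rfl⟩ : ∃ k, K = k + 1 := ⟨K - 1, by omega⟩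
    obtain ⟨B, hB, hBq⟩ := hK₀ k m (by omega) hm
    exact ⟨B, (posRootLawAt_iff_strictMono m k B).2 hB, hBq⟩

/-! ## §5 The Loewner (one-sided) sector at all fat formats, `ζ`-currency -/

/-- **The Loewner sector satisfies the crux's `ζ`-currency inequality at all fat formats.**  For all `c, q` there is
`K₀` such that for `K ≥ K₀`, `m ≤ 2^((⌊log₂(K+1)⌋+c)^c)`, every `(K+1)`-term pencil `X^e J + ∑ₖ X^(d k) P_k` with
`J` symmetric, all `P_k` positive semidefinite and the exceptional exponent `e` extremal (`e ≤ d k` for all `k`, or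
`d k ≤ e` for all `k`) has `(2 Z₊ + 1)^q ≤ 2^((K+1)⌊log₂(K+1)⌋)`.  Input: the tree's K-free rung `firstRung_oneSided`
(`Z₊ ≤ m`, Loewner monotonicity) and `Census.fatFormat_absorb`.  The `ζ`-currency form `(2B+1)^q` is the one in which
the crux is stated format-wise (`Census.matrixDescartes_iff_posRootLaw`); no all-real-zeros statement is claimed for
this sector (reflection `X ↦ −X` does not preserve it). [folklore] -/
theorem matrixDescartes_loewnerSector_pos (c q : ℕ) : ∃ K₀ : ℕ, ∀ K m : ℕ, K₀ ≤ K →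
    m ≤ 2 ^ ((Nat.log 2 (K + 1) + c) ^ c) →
    ∀ (e : ℕ) (d : Fin K → ℕ) (J : Matrix (Fin m) (Fin m) ℝ) (P : Fin K → Matrix (Fin m) (Fin m) ℝ),
      J.IsSymm → (∀ k, (P k).PosSemidef) → ((∀ k, e ≤ d k) ∨ (∀ k, d k ≤ e)) →
      (2 * ((Matrix.det (((Polynomial.X : Polynomial ℝ) ^ e) • J.map Polynomial.C
          + ∑ k, ((Polynomial.X : Polynomial ℝ) ^ d k) • (P k).map Polynomial.C)).roots.toFinset.filter
            (fun t => 0 < t)).card + 1) ^ q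
        ≤ 2 ^ ((K + 1) * Nat.log 2 (K + 1)) := by
  obtain ⟨K₀, hK₀⟩ := fatFormat_absorb 1 c q
  refine ⟨K₀, fun K m hK hm e d J P hJ hP hone => hK₀ (K + 1) m _ (by omega) hm ?_⟩
  have h1 := firstRung_oneSided (Fin m) (Fin K) e d J P hJ hP hone
  rw [Fintype.card_fin] at h1
  nlinarith [h1]

end Summit.ValiantsHypothesis.ValiantsHypothesis.Theorems.LacunarySymmetroidMatrixDescartes.Census
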